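import Mathlib
import Summits.Ventures.HodgeRepro2.Tier7.Line1.SepCurve

/-!
# Tier7/Line1/SepCurveAut — the `ℂ`-algebra structure, the Hecke translates and the conjugation of a curve algebra

Continuation of `SepCurve` (t7-L1-p2, LINE L1 residual probe — the SEPARATING DATUM): `Curve R V J β` is a
`ℂ`-algebra when `R` is (`Algebra.ofModule`), a compatible triple `AutData` `(σ, τ, κ)` (a `ℂ`-algebra automorphism
of the base, `σ`-semilinear automorphisms of `V` and `J` preserving `β`) induces the `ℂ`-algebra automorphism
`AutData.toAlgEquiv` — the shape of every Hecke translate of the datum —, and compatible antilinear involutions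
`BarData` induce the antilinear ring involution `BarData.bar` (complex conjugation of the datum).
`import Mathlib` + `SepCurve`. Author: t7-L1-p2 (prover-pub-hodge-repro2-t7-L1-p2-g0-0). §8(d): NO.
-/

namespace Summit.Ventures.HodgeRepro2.Tier7.Line1.Sep

noncomputable section

section AlgebraPart

variable {R : Type*} [CommRing R] [Algebra ℂ R] {V : Type*} [AddCommGroup V] [Module R V] [Module ℂ V]
  [IsScalarTower ℂ R V] {J : Type*} [AddCommGroup J] [Module R J] [Module ℂ J] [IsScalarTower ℂ R J]

namespace Curve

/-- a compatible triple: a `ℂ`-algebra automorphism `σ` of `R`, `σ`-semilinear `ℂ`-linear automorphisms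
`τ` of `V` and `κ` of `J` with `β (τ v) (τ w) = σ (β v w)` -/
structure AutData (β : V →ₗ[R] V →ₗ[R] R) where
  /-- the automorphism of the base -/
  σ : R ≃ₐ[ℂ] R
  /-- the automorphism of `V` -/
  τ : V ≃ₗ[ℂ] V
  /-- the automorphism of `J` -/
  κ : J ≃ₗ[ℂ] J
  /-- `τ` is `σ`-semilinear -/
  τ_smul : ∀ (r : R) (v : V), τ (r • v) = σ r • τ v
  /-- `κ` is `σ`-semilinear -/
  κ_smul : ∀ (r : R) (j : J), κ (r • j) = σ r • κ j
  /-- `β` is `σ`-compatible -/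
  β_map : ∀ v w, β (τ v) (τ w) = σ (β v w)

variable {β : V →ₗ[R] V →ₗ[R] R}

/-- the `ℂ`-algebra structure -/
instance : Algebra ℂ (Curve R V J β) :=
  Algebra.ofModule
    (fun z x y => by
      ext
      · simp [Algebra.smul_mul_assoc]
      · simp only [mul_v, smul_c, smul_v, smul_add, smul_assoc, smul_comm z y.c]
      · simp only [mul_t, smul_c, smul_v, smul_t, smul_add, Algebra.smul_mul_assoc,
          Algebra.mul_smul_comm, LinearMap.map_smul_of_tower, LinearMap.smul_apply]
      · simp only [mul_j, smul_c, smul_j, smul_add, smul_assoc, smul_comm z y.c])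
    (fun z x y => by
      ext
      · simp [Algebra.mul_smul_comm]
      · simp only [mul_v, smul_c, smul_v, smul_add, smul_assoc, smul_comm z x.c]
      · simp only [mul_t, smul_c, smul_v, smul_t, smul_add, Algebra.mul_smul_comm,
          Algebra.smul_mul_assoc, LinearMap.map_smul_of_tower]
      · simp only [mul_j, smul_c, smul_j, smul_add, smul_assoc, smul_comm z x.c])

/-- the structure map -/
theorem algebraMap_apply (z : ℂ) :
    algebraMap ℂ (Curve R V J β) z = ⟨algebraMap ℂ R z, 0, 0, 0⟩ := by
  rw [Algebra.algebraMap_eq_smul_one]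
  ext <;> simp [Algebra.algebraMap_eq_smul_one]

/-- the `c`-component of a scalar -/
@[simp] theorem algebraMap_c (z : ℂ) : (algebraMap ℂ (Curve R V J β) z).c = algebraMap ℂ R z := by
  rw [algebraMap_apply]
/-- the `v`-component of a scalar -/
@[simp] theorem algebraMap_v (z : ℂ) : (algebraMap ℂ (Curve R V J β) z).v = 0 := by
  rw [algebraMap_apply]
/-- the `t`-component of a scalar -/
@[simp] theorem algebraMap_t (z : ℂ) : (algebraMap ℂ (Curve R V J β) z).t = 0 := by
  rw [algebraMap_apply]
/-- the `j`-component of a scalar -/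
@[simp] theorem algebraMap_j (z : ℂ) : (algebraMap ℂ (Curve R V J β) z).j = 0 := by
  rw [algebraMap_apply]

/-! ## Products of embedded elements -/

omit [IsScalarTower ℂ R V] [IsScalarTower ℂ R J] in
/-- the product of two degree-`1` elements is the top class `β v w` -/
theorem ofV_mul_ofV (v w : V) :
    ofV (J := J) (β := β) v * ofV (J := J) (β := β) w = ⟨0, 0, β v w, 0⟩ := by
  ext <;> simp [ofV_apply]

omit [IsScalarTower ℂ R V] [IsScalarTower ℂ R J] in
/-- the product of two junk elements is `0` -/
theorem ofJ_mul_ofJ (j j' : J) : ofJ (V := V) (β := β) j * ofJ (V := V) (β := β) j' = 0 := by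
  ext <;> simp [ofJ_apply]

omit [IsScalarTower ℂ R V] [IsScalarTower ℂ R J] in
/-- the product of a degree-`1` element with a junk element is `0` -/
theorem ofV_mul_ofJ (v : V) (j : J) : ofV (J := J) (β := β) v * ofJ (V := V) (β := β) j = 0 := by
  ext <;> simp [ofV_apply, ofJ_apply]

/-! ## Semilinear automorphisms (the Hecke translates) -/

/-- the induced `ℂ`-linear automorphism of the curve algebra -/
def AutData.toLinearEquiv (D : AutData (J := J) β) : Curve R V J β ≃ₗ[ℂ] Curve R V J β where
  toFun x := ⟨D.σ x.c, D.τ x.v, D.σ x.t, D.κ x.j⟩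
  invFun x := ⟨D.σ.symm x.c, D.τ.symm x.v, D.σ.symm x.t, D.κ.symm x.j⟩
  left_inv x := by ext <;> simp
  right_inv x := by ext <;> simp
  map_add' x y := by ext <;> simp
  map_smul' z x := by ext <;> simp

/-- the induced `ℂ`-algebra automorphism of the curve algebra (the Hecke translate) -/
def AutData.toAlgEquiv (D : AutData (J := J) β) : Curve R V J β ≃ₐ[ℂ] Curve R V J β :=
  AlgEquiv.ofLinearEquiv D.toLinearEquiv (by ext <;> simp [AutData.toLinearEquiv])
    (fun x y => by
      ext
      · simp [AutData.toLinearEquiv]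
      · simp [AutData.toLinearEquiv, D.τ_smul]
      · simp [AutData.toLinearEquiv, D.β_map]
      · simp [AutData.toLinearEquiv, D.κ_smul])

/-- the `c`-component of a Hecke translate -/
@[simp] theorem AutData.toAlgEquiv_c (D : AutData (J := J) β) (x : Curve R V J β) :
    (D.toAlgEquiv x).c = D.σ x.c := rfl
/-- the `v`-component of a Hecke translate -/
@[simp] theorem AutData.toAlgEquiv_v (D : AutData (J := J) β) (x : Curve R V J β) :
    (D.toAlgEquiv x).v = D.τ x.v := rfl
/-- the `t`-component of a Hecke translate -/
@[simp] theorem AutData.toAlgEquiv_t (D : AutData (J := J) β) (x : Curve R V J β) :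
    (D.toAlgEquiv x).t = D.σ x.t := rfl
/-- the `j`-component of a Hecke translate -/
@[simp] theorem AutData.toAlgEquiv_j (D : AutData (J := J) β) (x : Curve R V J β) :
    (D.toAlgEquiv x).j = D.κ x.j := rfl


end Curve

end AlgebraPart

section BarPart

variable {R : Type*} [CommRing R] [Algebra ℂ R] {V : Type*} [AddCommGroup V] [Module R V]
  {J : Type*} [AddCommGroup J] [Module R J]

namespace Curve

/-- compatible antilinear involutions of `R`, `V`, `J` -/
structure BarData (β : V →ₗ[R] V →ₗ[R] R) where
  /-- conjugation on the base -/
  bR : R → R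
  /-- conjugation on `V` -/
  bV : V → V
  /-- conjugation on `J` -/
  bJ : J → J
  bR_add : ∀ x y, bR (x + y) = bR x + bR y
  bR_mul : ∀ x y, bR (x * y) = bR x * bR y
  bR_one : bR 1 = 1
  bR_smul : ∀ (z : ℂ) (x : R), bR (z • x) = (starRingEnd ℂ) z • bR x
  bR_bR : ∀ x, bR (bR x) = x
  bV_add : ∀ v w, bV (v + w) = bV v + bV w
  bV_smul : ∀ (r : R) (v : V), bV (r • v) = bR r • bV v
  bV_bV : ∀ v, bV (bV v) = v
  bJ_add : ∀ j j', bJ (j + j') = bJ j + bJ j'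
  bJ_smul : ∀ (r : R) (j : J), bJ (r • j) = bR r • bJ j
  bJ_bJ : ∀ j, bJ (bJ j) = j
  β_bar : ∀ v w, β (bV v) (bV w) = bR (β v w)

variable {β : V →ₗ[R] V →ₗ[R] R}

/-! ## The antilinear involution (complex conjugation) -/

namespace BarData

variable (B : BarData (J := J) β)

/-- the induced conjugation on the curve algebra -/
def bar (x : Curve R V J β) : Curve R V J β := ⟨B.bR x.c, B.bV x.v, B.bR x.t, B.bJ x.j⟩

/-- the `c`-component of a conjugate -/
@[simp] theorem bar_c (x : Curve R V J β) : (B.bar x).c = B.bR x.c := rfl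
/-- the `v`-component of a conjugate -/
@[simp] theorem bar_v (x : Curve R V J β) : (B.bar x).v = B.bV x.v := rfl
/-- the `t`-component of a conjugate -/
@[simp] theorem bar_t (x : Curve R V J β) : (B.bar x).t = B.bR x.t := rfl
/-- the `j`-component of a conjugate -/
@[simp] theorem bar_j (x : Curve R V J β) : (B.bar x).j = B.bJ x.j := rfl

/-- `bR 0 = 0` -/
theorem bR_zero : B.bR 0 = 0 := by
  have h := B.bR_add 0 0
  rw [add_zero] at h
  exact add_left_cancel (h.symm.trans (add_zero _).symm)

/-- `bV 0 = 0` -/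
theorem bV_zero : B.bV 0 = 0 := by
  have h := B.bV_add 0 0
  rw [add_zero] at h
  exact add_left_cancel (h.symm.trans (add_zero _).symm)

/-- `bJ 0 = 0` -/
theorem bJ_zero : B.bJ 0 = 0 := by
  have h := B.bJ_add 0 0
  rw [add_zero] at h
  exact add_left_cancel (h.symm.trans (add_zero _).symm)

/-- conjugation of a scalar of the base -/
theorem bR_algebraMap (z : ℂ) : B.bR (algebraMap ℂ R z) = algebraMap ℂ R ((starRingEnd ℂ) z) := by
  rw [Algebra.algebraMap_eq_smul_one, B.bR_smul, B.bR_one, Algebra.algebraMap_eq_smul_one]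

/-- `bar` is additive -/
theorem bar_add (x y : Curve R V J β) : B.bar (x + y) = B.bar x + B.bar y := by
  ext <;> simp [B.bR_add, B.bV_add, B.bJ_add]

/-- `bar` is multiplicative -/
theorem bar_mul (x y : Curve R V J β) : B.bar (x * y) = B.bar x * B.bar y := by
  ext
  · simp [B.bR_mul]
  · simp [B.bV_add, B.bV_smul]
  · simp [B.bR_add, B.bR_mul, B.β_bar]
  · simp [B.bJ_add, B.bJ_smul]

/-- `bar` is an involution -/
theorem bar_bar (x : Curve R V J β) : B.bar (B.bar x) = x := by
  ext <;> simp [B.bR_bR, B.bV_bV, B.bJ_bJ]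

/-- `bar 0 = 0` -/
theorem bar_zero : B.bar 0 = 0 := by
  ext <;> simp [B.bR_zero, B.bV_zero, B.bJ_zero]


section BarSmul

variable [Module ℂ V] [IsScalarTower ℂ R V] [Module ℂ J] [IsScalarTower ℂ R J]

omit [Module ℂ J] [IsScalarTower ℂ R J] in
/-- `bV` is `ℂ`-antilinear -/
theorem bV_smul_complex (z : ℂ) (v : V) : B.bV (z • v) = (starRingEnd ℂ) z • B.bV v := by
  rw [← algebraMap_smul R z v, B.bV_smul, B.bR_algebraMap, algebraMap_smul]

omit [Module ℂ V] [IsScalarTower ℂ R V] in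
/-- `bJ` is `ℂ`-antilinear -/
theorem bJ_smul_complex (z : ℂ) (j : J) : B.bJ (z • j) = (starRingEnd ℂ) z • B.bJ j := by
  rw [← algebraMap_smul R z j, B.bJ_smul, B.bR_algebraMap, algebraMap_smul]

/-- `bar` is antilinear -/
theorem bar_smul (z : ℂ) (x : Curve R V J β) : B.bar (z • x) = (starRingEnd ℂ) z • B.bar x := by
  ext <;> simp [B.bR_smul, B.bV_smul_complex, B.bJ_smul_complex]

end BarSmul

end BarData

end Curve

end BarPart

end

end Summit.Ventures.HodgeRepro2.Tier7.Line1.Sep
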